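import Summits.MatrixMultiplication.OmegaCensus.STPPSmallPatternKernelReflect122X

/-!
# ω-census, small STPP pattern `(1,2,2)^k`: reflection for the chunked search with a STABILISER reduction of `c'₀`

HONEST FRAMING (pub-omega census; verbatim): lottery ticket; floor = certified bounds/negative ranges.
Census STRUCTURE bookkeeping of the STPP track (seat pub-omega-stpp-3, gen 24; STRUCTURE row B5, column `T2`), not progress on `ω`.

The chunked kernel search `STPP122Neg.search2x` (`STPPSmallPatternKernelSearch122.lean`) runs a representative `y`
(`B₀ = {0, y}`) over the first-level codes `c'₀` (`C₀ = {0, c'₀}`) outside an exclusion mask.  The reflection theorem of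
`STPPSmallPatternKernelReflect122X.lean` asks the chunks of `y` to cover ALL codes.  Here the cover hypothesis is weakened to
a cover MODULO A STABILISER: it suffices that every `z : G` is carried by some listed injective additive map FIXING the
representative element into a code allowed by one of the representative's chunks (`not_exists_isSTPP_122_of_search2x_stab`).
Soundness: applying such a map to a normal-form solution keeps the model, keeps `b₀ = c₀ = 0` and `b'₀`, and moves `c'₀`
into the allowed set; orientation and sorting are then restored as in `exists_normalForm2`.  With the full automorphism
group this divides the first level of the search by `|Stab(y)|`-orbits (e.g. one start instead of 24 for `(ℤ/3)³`).

References: H. Cohn, R. Kleinberg, B. Szegedy, C. Umans, FOCS 2005 (arXiv:math/0511460), Def. 5.1.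
-/

namespace Summit.MatrixMultiplication.OmegaCensus

namespace STPP122Neg

open STPP211Neg Literature.Computability.AlgebraicComplexity

section Refl

variable {G : Type} [AddCommGroup G] {E : GEnc G} {K : ℕ} {b b' c c' : Fin K → G}

/-- Applying an injective additive map preserves the model (`ModelD2.map_sub` with zero translations). -/
theorem ModelD2.map (hM : ModelD2 b b' c c') {G' : Type} [AddCommGroup G'] (f : G →+ G') (hf : Function.Injective f) :
    ModelD2 (fun i => f (b i)) (fun i => f (b' i)) (fun i => f (c i)) (fun i => f (c' i)) := by
  have h := hM.map_sub f hf 0 0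
  simp only [sub_zero] at h
  exact h

/-- **NORMAL FORM WITH STABILISER REDUCTION**: beyond `exists_normalForm2` (translations, covering map, orientation, sorting),
the code of `c'₀` can be moved into any set `good (enc b'₀) ·` reached, from every element, by a listed injective additive map
fixing `b'₀`. -/
theorem exists_normalForm2_stab (E : GEnc G) (hM : ModelD2 b b' c c') (hK : 0 < K) {dlist : List ℕ}
    {auts : List (G →+ G)} (hinj : ∀ f ∈ auts, Function.Injective f)
    (hcover : ∀ d : G, d ≠ 0 → ∃ f ∈ auts, E.enc (f d) ∈ dlist)
    {stabs : List (G →+ G)} (hsinj : ∀ f ∈ stabs, Function.Injective f) {good : ℕ → ℕ → Prop}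
    (hgood : ∀ d : G, E.enc d ∈ dlist → ∀ z : G, ∃ f ∈ stabs, f d = d ∧ good (E.enc d) (E.enc (f z))) :
    ∃ p p' q q' : Fin K → G, ModelD2 p p' q q' ∧ NF2 E p p' q q' ∧ p ⟨0, hK⟩ = 0 ∧ q ⟨0, hK⟩ = 0 ∧
      E.enc (p' ⟨0, hK⟩) ∈ dlist ∧ good (E.enc (p' ⟨0, hK⟩)) (E.enc (q' ⟨0, hK⟩)) := by
  set i0 : Fin K := ⟨0, hK⟩
  obtain ⟨p, p', q, q', hMp, -, hp0, hq0, hd⟩ := exists_normalForm2 E hM hK hinj hcover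
  obtain ⟨f, hf, hfd, hfz⟩ := hgood (p' i0) hd (q' i0)
  have hfi := hsinj f hf
  -- apply the stabiliser map
  set b1 : Fin K → G := fun i => f (p i)
  set b1' : Fin K → G := fun i => f (p' i)
  set c1 : Fin K → G := fun i => f (q i)
  set c1' : Fin K → G := fun i => f (q' i)
  have hM1 : ModelD2 b1 b1' c1 c1' := hMp.map f hfi
  have hb1 : b1 i0 = 0 := by show f (p i0) = 0; rw [show p i0 = 0 from hp0, map_zero]
  have hc1 : c1 i0 = 0 := by show f (q i0) = 0; rw [show q i0 = 0 from hq0, map_zero]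
  have hb1' : b1' i0 = p' i0 := hfd
  -- orient (codes changed), then sort by the code of the smaller B-element
  set b2 : Fin K → G := fun i => if E.enc (b1 i) < E.enc (b1' i) then b1 i else b1' i
  set b2' : Fin K → G := fun i => if E.enc (b1 i) < E.enc (b1' i) then b1' i else b1 i
  set c2 : Fin K → G := fun i => if E.enc (c1 i) < E.enc (c1' i) then c1 i else c1' i
  set c2' : Fin K → G := fun i => if E.enc (c1 i) < E.enc (c1' i) then c1' i else c1 i
  have hM2 : ModelD2 b2 b2' c2 c2' := hM1.orient E
  have hB0 : E.enc (b1 i0) < E.enc (b1' i0) := by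
    rw [hb1, E.enc_zero]; refine Nat.pos_of_ne_zero fun h0 => hM1.1 i0 ?_
    rw [hb1]; exact (E.enc_inj (h0.trans E.enc_zero.symm)).symm
  have hC0 : E.enc (c1 i0) < E.enc (c1' i0) := by
    rw [hc1, E.enc_zero]; refine Nat.pos_of_ne_zero fun h0 => hM1.2.1 i0 ?_
    rw [hc1]; exact (E.enc_inj (h0.trans E.enc_zero.symm)).symm
  have hb2 : b2 i0 = 0 := by
    show (if E.enc (b1 i0) < E.enc (b1' i0) then b1 i0 else b1' i0) = 0
    rw [if_pos hB0, hb1]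
  have hb2' : b2' i0 = p' i0 := by
    show (if E.enc (b1 i0) < E.enc (b1' i0) then b1' i0 else b1 i0) = _
    rw [if_pos hB0, hb1']
  have hc2 : c2 i0 = 0 := by
    show (if E.enc (c1 i0) < E.enc (c1' i0) then c1 i0 else c1' i0) = 0
    rw [if_pos hC0, hc1]
  have hc2' : c2' i0 = f (q' i0) := by
    show (if E.enc (c1 i0) < E.enc (c1' i0) then c1' i0 else c1 i0) = _
    rw [if_pos hC0]
  have hlt2 : ∀ i, E.enc (b2 i) < E.enc (b2' i) ∧ E.enc (c2 i) < E.enc (c2' i) := by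
    intro i
    have hne1 : E.enc (b1 i) ≠ E.enc (b1' i) := fun e => hM1.1 i (E.enc_inj e)
    have hne2 : E.enc (c1 i) ≠ E.enc (c1' i) := fun e => hM1.2.1 i (E.enc_inj e)
    constructor
    · show E.enc (if E.enc (b1 i) < E.enc (b1' i) then b1 i else b1' i) <
        E.enc (if E.enc (b1 i) < E.enc (b1' i) then b1' i else b1 i)
      split_ifs with h
      · exact h
      · omega
    · show E.enc (if E.enc (c1 i) < E.enc (c1' i) then c1 i else c1' i) <
        E.enc (if E.enc (c1 i) < E.enc (c1' i) then c1' i else c1 i)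
      split_ifs with h
      · exact h
      · omega
  -- sort
  set σ := Tuple.sort (fun i => E.enc (b2 i))
  have hmono : Monotone ((fun i => E.enc (b2 i)) ∘ σ) := Tuple.monotone_sort _
  have hM3 : ModelD2 (b2 ∘ σ) (b2' ∘ σ) (c2 ∘ σ) (c2' ∘ σ) := hM2.reindex σ σ.injective
  have hinjb : Function.Injective (fun i => E.enc ((b2 ∘ σ) i)) := by
    intro i j h
    have h' : b2 (σ i) = b2 (σ j) := E.enc_inj h
    have hin : InA b2 b2' (σ j) (b2 (σ i)) := by rw [h']; exact inA_p (σ j)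
    exact σ.injective (hM2.b_disj (inA_p (σ i)) hin)
  have hsm : StrictMono (fun i => E.enc ((b2 ∘ σ) i)) := hmono.strictMono_of_injective hinjb
  have hσ0 : σ i0 = i0 := by
    have hi0le : i0 ≤ σ.symm i0 := by rw [Fin.le_def]; exact Nat.zero_le _
    have hle : E.enc (b2 (σ i0)) ≤ E.enc (b2 (σ (σ.symm i0))) := hmono hi0le
    rw [Equiv.apply_symm_apply, hb2, E.enc_zero] at hle
    have h00 : E.enc ((b2 ∘ σ) i0) = E.enc ((b2 ∘ σ) (σ.symm i0)) := by
      show E.enc (b2 (σ i0)) = E.enc (b2 (σ (σ.symm i0))); rw [Equiv.apply_symm_apply, hb2, E.enc_zero]; omega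
    have h3 := congrArg σ (hinjb h00)
    rw [Equiv.apply_symm_apply] at h3
    exact h3
  refine ⟨b2 ∘ σ, b2' ∘ σ, c2 ∘ σ, c2' ∘ σ, hM3, ⟨fun i j hij => hsm hij, fun i => (hlt2 (σ i)).1, fun i => (hlt2 (σ i)).2⟩,
    ?_, ?_, ?_, ?_⟩
  · show b2 (σ i0) = 0; rw [hσ0, hb2]
  · show c2 (σ i0) = 0; rw [hσ0, hc2]
  · show E.enc (b2' (σ i0)) ∈ dlist; rw [hσ0, hb2']; exact hd
  · show good (E.enc (b2' (σ i0))) (E.enc (c2' (σ i0))); rw [hσ0, hb2', hc2']; exact hfz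

/-- **REFLECTION (difference model), chunked search, stabiliser cover.** -/
theorem not_modelD2_of_search2x_stab (E : GEnc G) (hK : 0 < K) {chunks : List (ℕ × ℕ)}
    (hsearch : search2x E.g K chunks = true) {reps : List ℕ} {auts : List (G →+ G)}
    (hinj : ∀ f ∈ auts, Function.Injective f) (hcover : ∀ d : G, d ≠ 0 → ∃ f ∈ auts, E.enc (f d) ∈ reps)
    {stabs : List (G →+ G)} (hsinj : ∀ f ∈ stabs, Function.Injective f)
    (hchunks : ∀ d : G, E.enc d ∈ reps → ∀ z : G, ∃ f ∈ stabs, f d = d ∧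
      ∃ e ∈ chunks, e.1 = E.enc d ∧ e.2.testBit (E.enc (f z)) = false)
    (b b' c c' : Fin K → G) : ¬ ModelD2 b b' c c' := by
  intro hM
  obtain ⟨p, p', q, q', hM', hNF, hp0, hq0, -, e, he, h1, h2⟩ :=
    exists_normalForm2_stab E hM hK hinj hcover hsinj
      (good := fun y z => ∃ e ∈ chunks, e.1 = y ∧ e.2.testBit z = false) hchunks
  have := start2x_of_search2x hsearch e he
  obtain ⟨y, x1⟩ := e
  simp only at h1 h2
  subst h1
  rw [start2x_false hM' hNF hK hp0 hq0 h2] at this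
  exact Bool.false_ne_true this

/-- **REFLECTION THROUGH DEF. 5.1, chunked search with stabiliser cover** (pattern `(1,2,2)^k`): a `true` `search2x`, the
covering maps of the representatives `reps` (`auts`), and injective additive maps `stabs` such that every element is carried,
by a map FIXING the representative element `d` (`enc d ∈ reps`), into a first-level code allowed by one of `d`'s chunks —
together exclude every STPP family (CKSU Def. 5.1, tree `IsSTPP`) of `K` triples with `|Aᵢ| = 1`, `|Bᵢ| = |Cᵢ| = 2`.
[cite: CohnKleinbergSzegedyUmans2005, Def. 5.1] -/
theorem not_exists_isSTPP_122_of_search2x_stab [DecidableEq G] (E : GEnc G) (hK : 0 < K) {chunks : List (ℕ × ℕ)}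
    (hsearch : search2x E.g K chunks = true) {reps : List ℕ} {auts : List (G →+ G)}
    (hinj : ∀ f ∈ auts, Function.Injective f) (hcover : ∀ d : G, d ≠ 0 → ∃ f ∈ auts, E.enc (f d) ∈ reps)
    {stabs : List (G →+ G)} (hsinj : ∀ f ∈ stabs, Function.Injective f)
    (hchunks : ∀ d : G, E.enc d ∈ reps → ∀ z : G, ∃ f ∈ stabs, f d = d ∧
      ∃ e ∈ chunks, e.1 = E.enc d ∧ e.2.testBit (E.enc (f z)) = false) :
    ¬ ∃ A B C : Fin K → Finset G, IsSTPP A B C ∧ ∀ i, (A i).card = 1 ∧ (B i).card = 2 ∧ (C i).card = 2 := by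
  rw [exists_isSTPP_122_iff]
  rintro ⟨p, p', q, q', hb, hc, hU, hX⟩
  exact not_modelD2_of_search2x_stab E hK hsearch hinj hcover hsinj hchunks p p' q q' (modelD2_of_finsetForm hb hc hU hX)


/-- Members of the hom list built from a list `L` of additive FUNCTIONS are, as functions, members of `L`. -/
theorem coe_mem_of_mem_attach_map {L : List (G → G)} {hadd : ∀ f ∈ L, ∀ a b : G, f (a + b) = f a + f b} {φ : G →+ G}
    (h : φ ∈ L.attach.map fun p => AddMonoidHom.mk' p.1 (hadd p.1 p.2)) : ∃ f ∈ L, ⇑φ = f := by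
  obtain ⟨p, -, rfl⟩ := List.mem_map.1 h
  exact ⟨p.1, p.2, rfl⟩

/-- Every member of `L` is represented in the hom list built from `L`. -/
theorem exists_mem_attach_map {L : List (G → G)} (hadd : ∀ f ∈ L, ∀ a b : G, f (a + b) = f a + f b) {f : G → G}
    (hf : f ∈ L) : ∃ φ ∈ L.attach.map fun p => AddMonoidHom.mk' p.1 (hadd p.1 p.2), ⇑φ = f :=
  ⟨AddMonoidHom.mk' f (hadd f hf), List.mem_map.2 ⟨⟨f, hf⟩, List.mem_attach _ _, rfl⟩, rfl⟩

/-- **REFLECTION THROUGH DEF. 5.1, chunked search with stabiliser cover — FUNCTION-LIST FORM**: the covering maps and the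
stabiliser maps are given as plain functions `G → G` (e.g. by generator images) whose additivity, injectivity and covering
properties are separate (kernel-decidable) hypotheses; the homs are assembled by `List.attach`/`AddMonoidHom.mk'`.  [cite: CohnKleinbergSzegedyUmans2005, Def. 5.1] -/
theorem not_exists_isSTPP_122_of_search2x_stabF [DecidableEq G] (E : GEnc G) (hK : 0 < K) {chunks : List (ℕ × ℕ)}
    (hsearch : search2x E.g K chunks = true) {reps : List ℕ} {auts : List (G → G)}
    (hadd : ∀ f ∈ auts, ∀ a b : G, f (a + b) = f a + f b) (hinj : ∀ f ∈ auts, Function.Injective f)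
    (hcover : ∀ d : G, d ≠ 0 → ∃ f ∈ auts, E.enc (f d) ∈ reps)
    {stabs : List (G → G)} (hsadd : ∀ f ∈ stabs, ∀ a b : G, f (a + b) = f a + f b)
    (hsinj : ∀ f ∈ stabs, Function.Injective f)
    (hchunks : ∀ d : G, E.enc d ∈ reps → ∀ z : G, ∃ f ∈ stabs, f d = d ∧
      ∃ e ∈ chunks, e.1 = E.enc d ∧ e.2.testBit (E.enc (f z)) = false) :
    ¬ ∃ A B C : Fin K → Finset G, IsSTPP A B C ∧ ∀ i, (A i).card = 1 ∧ (B i).card = 2 ∧ (C i).card = 2 := by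
  refine not_exists_isSTPP_122_of_search2x_stab E hK hsearch (reps := reps)
    (auts := auts.attach.map fun p => AddMonoidHom.mk' p.1 (hadd p.1 p.2))
    (stabs := stabs.attach.map fun p => AddMonoidHom.mk' p.1 (hsadd p.1 p.2)) (fun φ hφ => ?_) (fun d hd => ?_) (fun φ hφ => ?_) (fun d hd z => ?_)
  · obtain ⟨f, hf, hφf⟩ := coe_mem_of_mem_attach_map hφ
    rw [hφf]; exact hinj f hf
  · obtain ⟨f, hf, hfd⟩ := hcover d hd
    obtain ⟨φ, hφ, hφf⟩ := exists_mem_attach_map hadd hf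
    exact ⟨φ, hφ, by rw [hφf]; exact hfd⟩
  · obtain ⟨f, hf, hφf⟩ := coe_mem_of_mem_attach_map hφ
    rw [hφf]; exact hsinj f hf
  · obtain ⟨f, hf, hfd, hrest⟩ := hchunks d hd z
    obtain ⟨φ, hφ, hφf⟩ := exists_mem_attach_map hsadd hf
    exact ⟨φ, hφ, by rw [hφf]; exact hfd, by rw [hφf]; exact hrest⟩

end Refl

end STPP122Neg

end Summit.MatrixMultiplication.OmegaCensus
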